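import Literature.ModelTheory.FiniteModelTheory.LFP
import HarnessLib

/-!
# FO(IFP) with order: formula combinators and tuple arithmetic

Topic `Literature/ModelTheory/FiniteModelTheory`; toolkit for the discharge of the named fact
`Literature.ModelTheory.FiniteModelTheory.exists_sentence_natOrder_of_mem_P` (`LFP.lean`; Gurevich 1984, §4,
Theorem 3, (1) → (3): every polynomial-time class of finite structures is definable in FO + IFP
with the natural order; Immerman 1986; Vardi 1982; Immerman 1999, Thm. 4.10).

Over the expansions `withNatOrder R` (symbol `0` of `2 :: ar` = the natural strict order of the
universe `Fin N`) this file provides, for the calculus `Formula` of `LFP.lean`: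

* generic facts on inflationary fixed points on FINITE types (`exists_ifp_eq_ifpStages`: the
  stages stabilise, Gurevich 1984 §4 Claim 2; `ifp_eq_of_rank`: a sound and rank-complete
  operator has the intended fixed point — the workhorse for every induction below);
* formula combinators with `simp` semantics (`verum`, `lAnd/lOr/iAnd/iOr/fAnd/fOr`, blocks of
  quantifiers `exs`/`alls` evaluated with `Fin.append`, the innermost relation variable `rv0`,
  input atoms `tab`);
* order primitives `ltV`, `zeroV`, `maxV`, `succV`, `oneV`;
* TUPLES AS NUMBERS `< N ^ d` (little-endian base `N`, `tval := finFunctionFinEquiv`, matching the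
  layout of tables in `encodingSNPInstance`): `eqT`, `ltT` (`tval_lt_tval_iff`), `zeroT`, `succT`,
  numerals `isConstT`, shifts `shiftT`, powers `isPowT`, codes of finite data `isCode`/`codeVal`;
* INFLATIONARY INDUCTIONS: doubling `dblT` (hence `halfT`, `oddT`) and the generic iteration
  combinator `iterT` of a definable step along a counter (`eval_iterT`, via `ReachIn`), with the
  instances `addT` (addition), `powTwoT` (`2 ^ i`), `divPowTwoT` (`⌊N ^ k / 2 ^ i⌋`, whose
  parities are the binary digits of `N`). This is the arithmetic that "FO + LFP with order allows
  one to speak about" (Gurevich 1984, §4, PDF p. 203).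

Every builder `B args : Formula (2 :: ar) rv n` is polymorphic in the relation-variable context
`rv` and takes its variables as maps `Fin d → Fin n` (higher-order abstract syntax: no renaming
infrastructure is needed), and comes with `@[simp] eval_B : (B args).eval (withNatOrder R) V σ ↔ …`.

## References

* Y. Gurevich, *Toward logic tailored for computational complexity*, in: Computation and Proof
  Theory, LNM 1104 (1984) 175–216, §4 (Claim 2; Theorems 2–3; remark on global functions).
* N. Immerman, *Relational queries computable in polynomial time*, Inform. and Control 68 (1986);
  N. Immerman, *Descriptive Complexity* (1999), §1.2 and Thm. 4.10.
-/

namespace Literature.ModelTheory.FiniteModelTheory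

open _root_.Computability Literature.Computability.Complexity Literature.Computability.Cryptography

/-! ### Inflationary fixed points on finite types -/

section IFP

variable {α : Type}

/-- Unfolding one inflationary stage: `X^{i+1} = Xⁱ ∪ F(Xⁱ)`. [folklore] -/
theorem ifpStages_succ (F : Set α → Set α) (i : ℕ) :
    ifpStages F (i + 1) = ifpStages F i ∪ F (ifpStages F i) := rfl

/-- `F(Xⁱ) ⊆ X^{i+1}`. [folklore] -/
theorem subset_ifpStages_succ (F : Set α → Set α) (i : ℕ) : F (ifpStages F i) ⊆ ifpStages F (i + 1) :=
  Set.subset_union_right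

/-- Membership in the inflationary fixed point is membership in some stage. [folklore] -/
theorem mem_ifp_iff (F : Set α → Set α) (a : α) : a ∈ ifp F ↔ ∃ i, a ∈ ifpStages F i := by
  simp [ifp]

/-- Induction principle: a property closed under the operator on stages holds on the fixed point. [folklore] -/
theorem ifp_subset_of_stages {F : Set α → Set α} {P : Set α}
    (h : ∀ i, ifpStages F i ⊆ P → F (ifpStages F i) ⊆ P) : ifp F ⊆ P := by
  have : ∀ i, ifpStages F i ⊆ P := by
    intro i
    induction i with
    | zero => simp [ifpStages]
    | succ i ih => exact Set.union_subset ih (h i ih)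
  exact Set.iUnion_subset this

/-- If two consecutive stages agree, all later stages agree. [folklore] -/
theorem ifpStages_eq_of_eq {F : Set α → Set α} {m : ℕ} (h : ifpStages F (m + 1) = ifpStages F m) :
    ∀ i, m ≤ i → ifpStages F i = ifpStages F m := by
  intro i hi
  obtain ⟨d, rfl⟩ := Nat.exists_eq_add_of_le hi
  induction d with
  | zero => rfl
  | succ d ih =>
    rw [← Nat.add_assoc, ifpStages_succ, ih (by omega)]
    rw [ifpStages_succ] at h
    exact h

/-- On a finite type the stages stabilise: some stage is the fixed point, after at most
`Nat.card α` steps. [cite: Gurevich1984, §4 Claim 2 (iterative fixed points close after |S|^ℓ stages)] -/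
theorem exists_ifp_eq_ifpStages [Finite α] (F : Set α → Set α) :
    ∃ m ≤ Nat.card α, ifp F = ifpStages F m ∧ ifpStages F (m + 1) = ifpStages F m := by
  classical
  haveI := Fintype.ofFinite α
  -- if stage (i+1) ≠ stage i for all i ≤ card, cardinalities strictly increase: impossible
  by_contra hcon
  push Not at hcon
  have hstrict : ∀ i ≤ Nat.card α, ifpStages F i ⊂ ifpStages F (i + 1) := by
    intro i hi
    refine (ifpStages_mono F (Nat.le_succ i)).ssubset_of_ne fun heq => ?_
    refine hcon i hi ?_ heq.symm
    apply subset_antisymm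
    · refine Set.iUnion_subset fun j => ?_
      rcases le_total j i with hji | hij
      · exact ifpStages_mono F hji
      · exact (ifpStages_eq_of_eq heq.symm j hij).le
    · exact ifpStages_subset_ifp F i
  have hcard : ∀ i ≤ Nat.card α + 1, i ≤ (ifpStages F i).toFinset.card := by
    intro i hi
    induction i with
    | zero => simp
    | succ i ih =>
      have h1 := ih (by omega)
      have h2 : (ifpStages F i).toFinset ⊂ (ifpStages F (i + 1)).toFinset := by
        simpa using hstrict i (by omega)
      have := Finset.card_lt_card h2
      omega
  have := hcard (Nat.card α + 1) le_rfl
  have hle : (ifpStages F (Nat.card α + 1)).toFinset.card ≤ Fintype.card α := Finset.card_le_univ _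
  rw [Nat.card_eq_fintype_card] at this hle
  omega

/-- On a finite type the inflationary fixed point is closed under the operator. [cite: Gurevich1984, §4 Claim 2 (iterative fixed points close after |S|^ℓ stages)] -/
theorem apply_ifp_subset_ifp [Finite α] (F : Set α → Set α) : F (ifp F) ⊆ ifp F := by
  obtain ⟨m, -, hm, hm1⟩ := exists_ifp_eq_ifpStages F
  rw [hm]
  calc F (ifpStages F m) ⊆ ifpStages F (m + 1) := subset_ifpStages_succ F m
    _ = ifpStages F m := hm1

/-- Characterisation of the fixed point by soundness and completeness w.r.t. a target set. [folklore] -/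
theorem ifp_eq_of {F : Set α → Set α} {P : Set α}
    (hsound : ∀ i, ifpStages F i ⊆ P → F (ifpStages F i) ⊆ P)
    (hcomplete : P ⊆ ifp F) : ifp F = P :=
  subset_antisymm (ifp_subset_of_stages hsound) hcomplete

end IFP

/-! ### Formula combinators -/

section Combinators

variable {L : List ℕ} {rv : List ℕ} {n : ℕ}

/-- `⊤`. [folklore] -/
def Formula.verum : Formula L rv n := .all (.eq (Fin.last n) (Fin.last n))

/-- `⊥`. [folklore] -/
def Formula.falsum : Formula L rv n := .not .verum

/-- Implication. [folklore] -/
def Formula.imp (φ ψ : Formula L rv n) : Formula L rv n := .or (.not φ) ψ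

/-- Finite conjunction of a list. [folklore] -/
def Formula.lAnd : List (Formula L rv n) → Formula L rv n
  | [] => .verum
  | φ :: l => .and φ (Formula.lAnd l)

/-- Finite disjunction of a list. [folklore] -/
def Formula.lOr : List (Formula L rv n) → Formula L rv n
  | [] => .falsum
  | φ :: l => .or φ (Formula.lOr l)

/-- Conjunction over `Fin m`. [folklore] -/
def Formula.iAnd {m : ℕ} (f : Fin m → Formula L rv n) : Formula L rv n := Formula.lAnd (List.ofFn f)

/-- Disjunction over `Fin m`. [folklore] -/
def Formula.iOr {m : ℕ} (f : Fin m → Formula L rv n) : Formula L rv n := Formula.lOr (List.ofFn f)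

/-- A block of `d` existential quantifiers (new variables `Fin.natAdd n i`, old ones
`Fin.castAdd d a`). [folklore] -/
def Formula.exs : (d : ℕ) → Formula L rv (n + d) → Formula L rv n
  | 0, φ => φ
  | d + 1, φ => Formula.exs d (.ex φ)

/-- A block of `d` universal quantifiers. [folklore] -/
def Formula.alls : (d : ℕ) → Formula L rv (n + d) → Formula L rv n
  | 0, φ => φ
  | d + 1, φ => Formula.alls d (.all φ)

variable {N : ℕ} (R : RelTables L N) (V : RVAssign rv N) (σ : Fin n → Fin N)

/-- Semantics of `verum`. [folklore] -/
@[simp] theorem Formula.eval_verum : (Formula.verum : Formula L rv n).eval R V σ ↔ True := by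
  simp [Formula.verum, Formula.eval]

/-- Semantics of `falsum`. [folklore] -/
@[simp] theorem Formula.eval_falsum : (Formula.falsum : Formula L rv n).eval R V σ ↔ False := by
  simp [Formula.falsum, Formula.eval]

/-- Semantics of `imp`. [folklore] -/
@[simp] theorem Formula.eval_imp (φ ψ : Formula L rv n) :
    (φ.imp ψ).eval R V σ ↔ (φ.eval R V σ → ψ.eval R V σ) := by
  simp only [Formula.imp, Formula.eval]; tauto

/-- Semantics of negation (as a `simp` lemma). [folklore] -/
@[simp] theorem Formula.eval_not' (φ : Formula L rv n) : (Formula.not φ).eval R V σ ↔ ¬ φ.eval R V σ :=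
  Iff.rfl
/-- Semantics of conjunction (as a `simp` lemma). [folklore] -/
@[simp] theorem Formula.eval_and' (φ ψ : Formula L rv n) :
    (Formula.and φ ψ).eval R V σ ↔ φ.eval R V σ ∧ ψ.eval R V σ := Iff.rfl
/-- Semantics of disjunction (as a `simp` lemma). [folklore] -/
@[simp] theorem Formula.eval_or' (φ ψ : Formula L rv n) :
    (Formula.or φ ψ).eval R V σ ↔ φ.eval R V σ ∨ ψ.eval R V σ := Iff.rfl
/-- Semantics of `∃` (as a `simp` lemma): the new variable is appended with `Fin.snoc`. [folklore] -/
@[simp] theorem Formula.eval_ex' (φ : Formula L rv (n + 1)) :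
    (Formula.ex φ).eval R V σ ↔ ∃ a, φ.eval R V (Fin.snoc σ a) := Iff.rfl
/-- Semantics of `∀` (as a `simp` lemma). [folklore] -/
@[simp] theorem Formula.eval_all' (φ : Formula L rv (n + 1)) :
    (Formula.all φ).eval R V σ ↔ ∀ a, φ.eval R V (Fin.snoc σ a) := Iff.rfl
/-- Semantics of equality atoms (as a `simp` lemma). [folklore] -/
@[simp] theorem Formula.eval_eq' (a b : Fin n) :
    (Formula.eq a b : Formula L rv n).eval R V σ ↔ σ a = σ b := Iff.rfl
/-- Semantics of input atoms (as a `simp` lemma). [folklore] -/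
@[simp] theorem Formula.eval_rel' (i : Fin L.length) (v : Fin (L.get i) → Fin n) :
    (Formula.rel i v : Formula L rv n).eval R V σ ↔ R i (σ ∘ v) = true := Iff.rfl
/-- Semantics of relation-variable atoms (as a `simp` lemma). [folklore] -/
@[simp] theorem Formula.eval_rvar' (j : Fin rv.length) (v : Fin (rv.get j) → Fin n) :
    (Formula.rvar j v : Formula L rv n).eval R V σ ↔ (σ ∘ v) ∈ V j := Iff.rfl
/-- Semantics of the fixed-point constructor: membership of the argument tuple in the inflationary fixed point of the operator defined by the body. [folklore] -/
theorem Formula.eval_fp' (k : ℕ) (φ : Formula L (k :: rv) (n + k)) (t : Fin k → Fin n) :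
    (Formula.fp k φ t : Formula L rv n).eval R V σ ↔
      (σ ∘ t) ∈ ifp fun S : Set (Fin k → Fin N) => {a | φ.eval R (RVAssign.cons S V) (Fin.append σ a)} :=
  Iff.rfl

/-- The atom `X(x_{v 0}, …)` of the innermost relation variable `X` (index `0`, arity `k`). [folklore] -/
def Formula.rv0 {k : ℕ} (v : Fin k → Fin n) : Formula L (k :: rv) n := .rvar ⟨0, Nat.zero_lt_succ _⟩ v

/-- Semantics of the innermost relation variable under `RVAssign.cons`. [folklore] -/
@[simp] theorem Formula.eval_rv0 {k : ℕ} (S : Set (Fin k → Fin N)) (v : Fin k → Fin n) :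
    (Formula.rv0 v : Formula L (k :: rv) n).eval R (RVAssign.cons S V) σ ↔ (σ ∘ v) ∈ S :=
  Iff.rfl

/-- Semantics of `lAnd`. [folklore] -/
@[simp] theorem Formula.eval_lAnd (l : List (Formula L rv n)) :
    (Formula.lAnd l).eval R V σ ↔ ∀ φ ∈ l, φ.eval R V σ := by
  induction l with
  | nil => simp [Formula.lAnd]
  | cons φ l ih => simp [Formula.lAnd, ih]

/-- Semantics of `lOr`. [folklore] -/
@[simp] theorem Formula.eval_lOr (l : List (Formula L rv n)) :
    (Formula.lOr l).eval R V σ ↔ ∃ φ ∈ l, φ.eval R V σ := by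
  induction l with
  | nil => simp [Formula.lOr]
  | cons φ l ih => simp [Formula.lOr, ih]

/-- Semantics of `iAnd`. [folklore] -/
@[simp] theorem Formula.eval_iAnd {m : ℕ} (f : Fin m → Formula L rv n) :
    (Formula.iAnd f).eval R V σ ↔ ∀ i, (f i).eval R V σ := by
  simp [Formula.iAnd, List.mem_ofFn]

/-- Semantics of `iOr`. [folklore] -/
@[simp] theorem Formula.eval_iOr {m : ℕ} (f : Fin m → Formula L rv n) :
    (Formula.iOr f).eval R V σ ↔ ∃ i, (f i).eval R V σ := by
  simp [Formula.iOr, List.mem_ofFn]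

/-- Conjunction over a finite index type. [folklore] -/
noncomputable def Formula.fAnd {ι : Type} [Finite ι] (f : ι → Formula L rv n) : Formula L rv n :=
  Formula.iAnd fun i : Fin (Nat.card ι) => f ((Finite.equivFin ι).symm i)

/-- Disjunction over a finite index type. [folklore] -/
noncomputable def Formula.fOr {ι : Type} [Finite ι] (f : ι → Formula L rv n) : Formula L rv n :=
  Formula.iOr fun i : Fin (Nat.card ι) => f ((Finite.equivFin ι).symm i)

/-- Semantics of `fAnd`. [folklore] -/
@[simp] theorem Formula.eval_fAnd {ι : Type} [Finite ι] (f : ι → Formula L rv n) :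
    (Formula.fAnd f).eval R V σ ↔ ∀ i, (f i).eval R V σ := by
  simp only [Formula.fAnd, Formula.eval_iAnd]
  exact ⟨fun h i => by simpa using h (Finite.equivFin ι i), fun h i => h _⟩

/-- Semantics of `fOr`. [folklore] -/
@[simp] theorem Formula.eval_fOr {ι : Type} [Finite ι] (f : ι → Formula L rv n) :
    (Formula.fOr f).eval R V σ ↔ ∃ i, (f i).eval R V σ := by
  simp only [Formula.fOr, Formula.eval_iOr]
  exact ⟨fun ⟨i, h⟩ => ⟨_, h⟩, fun ⟨i, h⟩ => ⟨Finite.equivFin ι i, by simpa using h⟩⟩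

/-- Semantics of a block of `d` existential quantifiers: the block is appended with `Fin.append`. [folklore] -/
theorem Formula.eval_exs : ∀ (d : ℕ) (φ : Formula L rv (n + d)) (σ : Fin n → Fin N),
    (Formula.exs d φ).eval R V σ ↔ ∃ a : Fin d → Fin N, φ.eval R V (Fin.append σ a)
  | 0, φ, σ => by
    simp only [Formula.exs]
    constructor
    · intro h; exact ⟨Fin.elim0, by simpa using h⟩
    · rintro ⟨a, h⟩
      have : a = Fin.elim0 := funext fun i => i.elim0
      subst this; simpa using h
  | d + 1, φ, σ => by
    rw [Formula.exs, Formula.eval_exs d]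
    simp only [Formula.eval]
    constructor
    · rintro ⟨a, x, h⟩
      exact ⟨Fin.snoc a x, by rwa [Fin.append_snoc]⟩
    · rintro ⟨a, h⟩
      refine ⟨Fin.init a, a (Fin.last d), ?_⟩
      rwa [← Fin.append_snoc, Fin.snoc_init_self]

/-- Semantics of a block of `d` universal quantifiers. [folklore] -/
theorem Formula.eval_alls : ∀ (d : ℕ) (φ : Formula L rv (n + d)) (σ : Fin n → Fin N),
    (Formula.alls d φ).eval R V σ ↔ ∀ a : Fin d → Fin N, φ.eval R V (Fin.append σ a)
  | 0, φ, σ => by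
    simp only [Formula.alls]
    constructor
    · intro h a
      have : a = Fin.elim0 := funext fun i => i.elim0
      subst this; simpa using h
    · intro h; simpa using h Fin.elim0
  | d + 1, φ, σ => by
    rw [Formula.alls, Formula.eval_alls d]
    simp only [Formula.eval]
    constructor
    · intro h a
      rw [← Fin.snoc_init_self a, Fin.append_snoc]
      exact h _ _
    · intro h a x
      rw [← Fin.append_snoc]
      exact h _

end Combinators

/-! ### The order symbol and element-level primitives (vocabulary `2 :: ar`) -/

section Order

variable {ar : List ℕ} {rv : List ℕ} {n : ℕ}

/-- The index of the order symbol. [folklore] -/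
def ordIdx (ar : List ℕ) : Fin (2 :: ar).length := ⟨0, Nat.zero_lt_succ _⟩

/-- `x_a < x_b`. [folklore] -/
def Formula.ltV (a b : Fin n) : Formula (2 :: ar) rv n := .rel (ordIdx ar) ![a, b]

/-- The atom `R_i(x_{v 0}, …)` of the INPUT symbol `i` of `ar` (symbol `i.succ` of `2 :: ar`). [folklore] -/
def Formula.tab (i : Fin ar.length) (v : Fin (ar.get i) → Fin n) : Formula (2 :: ar) rv n := .rel i.succ v

/-- `x_a` is the least element: `¬ ∃ z, z < x_a`. [folklore] -/
def Formula.zeroV (a : Fin n) : Formula (2 :: ar) rv n :=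
  .not (.ex (Formula.ltV (Fin.last n) a.castSucc))

/-- `x_a` is the greatest element. [folklore] -/
def Formula.maxV (a : Fin n) : Formula (2 :: ar) rv n :=
  .not (.ex (Formula.ltV a.castSucc (Fin.last n)))

/-- `x_b` is the successor of `x_a`. [folklore] -/
def Formula.succV (a b : Fin n) : Formula (2 :: ar) rv n :=
  .and (Formula.ltV a b)
    (.not (.ex (.and (Formula.ltV a.castSucc (Fin.last n)) (Formula.ltV (Fin.last n) b.castSucc))))

variable {N : ℕ} (R : RelTables ar N) (V : RVAssign rv N) (σ : Fin n → Fin N)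

/-- Post-composition with a vector of length two. [folklore] -/
theorem comp_vec2' {α : Type} (g : Fin n → α) (a b : Fin n) : g ∘ ![a, b] = ![g a, g b] := by
  funext i; fin_cases i <;> rfl

/-- Semantics of input atoms in a natural-order expansion: the table of `R` itself. [folklore] -/
@[simp] theorem Formula.eval_tab (i : Fin ar.length) (v : Fin (ar.get i) → Fin n) :
    (Formula.tab i v : Formula (2 :: ar) rv n).eval (withNatOrder R) V σ ↔ R i (σ ∘ v) = true :=
  Iff.rfl

/-- Semantics of `ltV` in a natural-order expansion: `<` on `Fin N`. [folklore] -/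
@[simp] theorem Formula.eval_ltV (a b : Fin n) :
    (Formula.ltV a b : Formula (2 :: ar) rv n).eval (withNatOrder R) V σ ↔ σ a < σ b := by
  simp only [Formula.ltV, Formula.eval, ordIdx]
  show natOrderTable N (σ ∘ ![a, b]) = true ↔ _
  rw [comp_vec2']
  simp [natOrderTable]

/-- Semantics of `zeroV`: the element `0`. [folklore] -/
@[simp] theorem Formula.eval_zeroV (a : Fin n) :
    (Formula.zeroV a : Formula (2 :: ar) rv n).eval (withNatOrder R) V σ ↔ (σ a : ℕ) = 0 := by
  simp only [Formula.zeroV, Formula.eval_not', Formula.eval_ex', Formula.eval_ltV, Fin.snoc_last,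
    Fin.snoc_castSucc, not_exists, not_lt]
  constructor
  · intro h
    have := h ⟨0, by have := (σ a).2; omega⟩
    exact Nat.le_zero.mp this
  · intro h z; exact Fin.le_def.mpr (by omega)

/-- Semantics of `maxV`: the element `N - 1`. [folklore] -/
@[simp] theorem Formula.eval_maxV (a : Fin n) :
    (Formula.maxV a : Formula (2 :: ar) rv n).eval (withNatOrder R) V σ ↔ (σ a : ℕ) = N - 1 := by
  simp only [Formula.maxV, Formula.eval_not', Formula.eval_ex', Formula.eval_ltV, Fin.snoc_last,
    Fin.snoc_castSucc, not_exists, not_lt]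
  constructor
  · intro h
    have := h ⟨N - 1, by have := (σ a).2; omega⟩
    have h2 := (σ a).2
    exact le_antisymm (by omega) (Fin.le_def.mp this)
  · intro h z; exact Fin.le_def.mpr (by have := z.2; omega)

/-- Semantics of `succV`: successor on `Fin N`. [folklore] -/
@[simp] theorem Formula.eval_succV (a b : Fin n) :
    (Formula.succV a b : Formula (2 :: ar) rv n).eval (withNatOrder R) V σ ↔
      (σ b : ℕ) = (σ a : ℕ) + 1 := by
  simp only [Formula.succV, Formula.eval_and', Formula.eval_not', Formula.eval_ex', Formula.eval_ltV,
    Fin.snoc_last, Fin.snoc_castSucc, not_exists, not_and, not_lt]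
  constructor
  · rintro ⟨h1, h2⟩
    have h1' : (σ a : ℕ) < σ b := h1
    by_contra hne
    have := h2 ⟨(σ a : ℕ) + 1, by have := (σ b).2; omega⟩ (Fin.lt_def.mpr (by simp))
    exact absurd (Fin.le_def.mp this) (by simp; omega)
  · intro h
    refine ⟨Fin.lt_def.mpr (by omega), fun z hz => Fin.le_def.mpr ?_⟩
    have := Fin.lt_def.mp hz
    omega

end Order

/-! ### Tuples as numbers (little-endian base `N`) -/

section Tuples

variable {ar : List ℕ} {rv : List ℕ} {n d : ℕ}

/-- The number coded by a tuple of elements, little-endian in base `N`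
(`finFunctionFinEquiv`: `∑ i, v i * N ^ i < N ^ d`). [folklore] -/
def tval {N d : ℕ} (v : Fin d → Fin N) : ℕ := (finFunctionFinEquiv v : ℕ)

/-- `tval v < N ^ d`. [folklore] -/
theorem tval_lt {N d : ℕ} (v : Fin d → Fin N) : tval v < N ^ d := (finFunctionFinEquiv v).2

/-- `tval` is injective. [folklore] -/
theorem tval_injective {N d : ℕ} : Function.Injective (tval (N := N) (d := d)) :=
  fun _ _ h => finFunctionFinEquiv.injective (Fin.ext h)

/-- Every number `< N ^ d` is the value of a tuple. [folklore] -/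
theorem exists_tval_eq {N d : ℕ} {m : ℕ} (hm : m < N ^ d) : ∃ v : Fin d → Fin N, tval v = m :=
  ⟨finFunctionFinEquiv.symm ⟨m, hm⟩, by simp [tval]⟩

/-- `tval v = ∑ i, v i * N ^ i`. [folklore] -/
theorem tval_eq_sum {N d : ℕ} (v : Fin d → Fin N) : tval v = ∑ i : Fin d, (v i : ℕ) * N ^ (i : ℕ) :=
  finFunctionFinEquiv_apply v

/-- Appending a most significant digit. [folklore] -/
theorem tval_snoc {N d : ℕ} (v : Fin d → Fin N) (a : Fin N) :
    tval (Fin.snoc v a : Fin (d + 1) → Fin N) = tval v + a * N ^ d := by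
  rw [tval_eq_sum, tval_eq_sum, Fin.sum_univ_castSucc]
  simp

/-- A tuple has value `0` iff all its digits are `0`. [folklore] -/
theorem tval_zero_iff {N d : ℕ} (v : Fin d → Fin N) : tval v = 0 ↔ ∀ i, (v i : ℕ) = 0 := by
  rw [tval_eq_sum, Finset.sum_eq_zero_iff]
  have hN : ∀ i : Fin d, 0 < N ^ (i : ℕ) := fun i => Nat.pow_pos (Nat.pos_of_ne_zero fun h => by
    subst h; exact (v i).elim0)
  simp only [Finset.mem_univ, forall_const, mul_eq_zero]
  exact forall_congr' fun i => ⟨fun h => h.resolve_right (by have := hN i; omega), fun h => Or.inl h⟩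

/-- Lexicographic comparison from the most significant digit is numeric comparison. [folklore] -/
theorem tval_lt_tval_iff : ∀ {d : ℕ} {N : ℕ} (v w : Fin d → Fin N),
    tval v < tval w ↔ ∃ i : Fin d, v i < w i ∧ ∀ j : Fin d, i < j → v j = w j
  | 0, N, v, w => by
    have hv : v = Fin.elim0 := funext fun i => i.elim0
    have hw : w = Fin.elim0 := funext fun i => i.elim0
    subst hv hw
    simp
  | d + 1, N, v, w => by
    rw [← Fin.snoc_init_self v, ← Fin.snoc_init_self w, tval_snoc, tval_snoc]
    have hv := tval_lt (Fin.init v)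
    have hw := tval_lt (Fin.init w)
    have ih := tval_lt_tval_iff (Fin.init v) (Fin.init w)
    set a := v (Fin.last d)
    set b := w (Fin.last d)
    constructor
    · intro h
      rcases lt_trichotomy (a : ℕ) b with hab | hab | hab
      · refine ⟨Fin.last d, ?_, fun j hj => absurd hj (not_lt.mpr (Fin.le_last j))⟩
        simpa using hab
      · have h' : tval (Fin.init v) < tval (Fin.init w) := by rw [hab] at h; omega
        obtain ⟨i, hi, hrest⟩ := ih.mp h'
        refine ⟨i.castSucc, by simpa using hi, fun j hj => ?_⟩
        rcases Fin.eq_castSucc_or_eq_last j with ⟨j, rfl⟩ | rfl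
        · simpa using hrest j (by simpa using hj)
        · simpa using Fin.ext hab
      · exfalso
        have : (b : ℕ) + 1 ≤ a := hab
        have := Nat.mul_le_mul_right (N ^ d) this
        rw [Nat.add_mul, one_mul] at this
        omega
    · rintro ⟨i, hi, hrest⟩
      rcases Fin.eq_castSucc_or_eq_last i with ⟨i, rfl⟩ | rfl
      · have hab : a = b := by simpa using hrest (Fin.last d) (by simp [Fin.castSucc_lt_last])
        have : tval (Fin.init v) < tval (Fin.init w) :=
          ih.mpr ⟨i, by simpa using hi, fun j hj => by simpa using hrest j.castSucc (by simpa using hj)⟩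
        rw [hab]; omega
      · have hab : (a : ℕ) < b := by simpa using hi
        have : ((a : ℕ) + 1) * N ^ d ≤ b * N ^ d := Nat.mul_le_mul_right _ hab
        rw [Nat.add_mul, one_mul] at this
        omega

/-- `x̄ = ȳ` componentwise. [folklore] -/
def Formula.eqT (x y : Fin d → Fin n) : Formula (2 :: ar) rv n :=
  Formula.iAnd fun i => .eq (x i) (y i)

/-- `x̄ < ȳ` as numbers (lexicographic from the most significant = last digit). [folklore] -/
def Formula.ltT (x y : Fin d → Fin n) : Formula (2 :: ar) rv n :=
  Formula.iOr fun i => .and (Formula.ltV (x i) (y i))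
    (Formula.iAnd fun j : Fin d => if i < j then .eq (x j) (y j) else .verum)

/-- `x̄ = 0`. [folklore] -/
def Formula.zeroT (x : Fin d → Fin n) : Formula (2 :: ar) rv n :=
  Formula.iAnd fun i => Formula.zeroV (x i)

/-- `ȳ = x̄ + 1`: `x̄ < ȳ` and nothing strictly between. [folklore] -/
def Formula.succT (x y : Fin d → Fin n) : Formula (2 :: ar) rv n :=
  .and (Formula.ltT x y)
    (.not (Formula.exs d (.and (Formula.ltT (Fin.castAdd d ∘ x) (Fin.natAdd n))
      (Formula.ltT (Fin.natAdd n) (Fin.castAdd d ∘ y)))))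

variable {N : ℕ} (R : RelTables ar N) (V : RVAssign rv N) (σ : Fin n → Fin N)

/-- Semantics of `eqT`. [folklore] -/
@[simp] theorem Formula.eval_eqT (x y : Fin d → Fin n) :
    (Formula.eqT x y : Formula (2 :: ar) rv n).eval (withNatOrder R) V σ ↔ σ ∘ x = σ ∘ y := by
  simp [Formula.eqT, funext_iff]

/-- Semantics of `ltT`: comparison of values. [folklore] -/
@[simp] theorem Formula.eval_ltT (x y : Fin d → Fin n) :
    (Formula.ltT x y : Formula (2 :: ar) rv n).eval (withNatOrder R) V σ ↔ tval (σ ∘ x) < tval (σ ∘ y) := by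
  rw [tval_lt_tval_iff]
  simp only [Formula.ltT, Formula.eval_iOr, Formula.eval_and', Formula.eval_ltV, Formula.eval_iAnd,
    Function.comp_apply]
  refine exists_congr fun i => and_congr_right fun _ => forall_congr' fun j => ?_
  by_cases h : i < j <;> simp [h]

/-- Semantics of `zeroT`. [folklore] -/
@[simp] theorem Formula.eval_zeroT (x : Fin d → Fin n) :
    (Formula.zeroT x : Formula (2 :: ar) rv n).eval (withNatOrder R) V σ ↔ tval (σ ∘ x) = 0 := by
  simp [Formula.zeroT, tval_zero_iff]

/-- Semantics of `succT`: successor of values (within range). [folklore] -/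
@[simp] theorem Formula.eval_succT (x y : Fin d → Fin n) :
    (Formula.succT x y : Formula (2 :: ar) rv n).eval (withNatOrder R) V σ ↔
      tval (σ ∘ y) = tval (σ ∘ x) + 1 := by
  simp only [Formula.succT, Formula.eval_and', Formula.eval_not', Formula.eval_exs, Formula.eval_ltT,
    not_exists, not_and, not_lt]
  have e1 : ∀ a : Fin d → Fin N, Fin.append σ a ∘ (Fin.castAdd d ∘ x) = σ ∘ x := fun a => by
    funext i; simp
  have e2 : ∀ a : Fin d → Fin N, Fin.append σ a ∘ (Fin.castAdd d ∘ y) = σ ∘ y := fun a => by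
    funext i; simp
  have e3 : ∀ a : Fin d → Fin N, Fin.append σ a ∘ (Fin.natAdd n) = a := fun a => by
    funext i; simp
  simp only [e1, e2, e3]
  constructor
  · rintro ⟨h1, h2⟩
    by_contra hne
    have hlt : tval (σ ∘ x) + 1 < N ^ d := by have := tval_lt (σ ∘ y); omega
    obtain ⟨z, hz⟩ := exists_tval_eq hlt
    have := h2 z (by omega)
    omega
  · intro h
    exact ⟨by omega, fun z hz => by omega⟩

end Tuples

/-! ### Ranked characterisation of inflationary fixed points -/

section IFPRank

variable {α : Type}

/-- If the operator is sound for a target set `P` on stages, and every element of `P` is produced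
by the operator from any sound set containing the elements of `P` of smaller rank, then the
inflationary fixed point is `P`. [cite: Gurevich1984, §4 Claim 2 (iterative fixed points close after |S|^ℓ stages)] -/
theorem ifp_eq_of_rank {F : Set α → Set α} {P : Set α} (rank : α → ℕ)
    (hsound : ∀ i, ifpStages F i ⊆ P → F (ifpStages F i) ⊆ P)
    (hcomplete : ∀ a ∈ P, ∀ S : Set α, {b | b ∈ P ∧ rank b < rank a} ⊆ S → S ⊆ P → a ∈ F S) :
    ifp F = P := by
  have hst : ∀ i, ifpStages F i ⊆ P := by
    intro i
    induction i with
    | zero => simp [ifpStages]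
    | succ i ih => exact Set.union_subset ih (hsound i ih)
  apply subset_antisymm (Set.iUnion_subset hst)
  suffices h : ∀ r, ∀ a ∈ P, rank a = r → a ∈ ifpStages F (r + 1) from
    fun a ha => ifpStages_subset_ifp F _ (h _ a ha rfl)
  intro r
  induction r using Nat.strong_induction_on with
  | _ r ih =>
    intro a ha har
    apply subset_ifpStages_succ
    apply hcomplete a ha _ _ (hst r)
    rintro b ⟨hb, hbr⟩
    rw [har] at hbr
    exact ifpStages_mono F (by omega) (ih (rank b) hbr b hb rfl)

end IFPRank

/-! ### Constants and constant shifts on tuples -/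

section Consts

variable {ar : List ℕ} {rv : List ℕ} {d : ℕ}

/-- `x̄ = c` for a numeral `c`. [folklore] -/
def Formula.isConstT : (c : ℕ) → {n : ℕ} → (Fin d → Fin n) → Formula (2 :: ar) rv n
  | 0, _, x => Formula.zeroT x
  | c + 1, n, x => Formula.exs d (.and (Formula.isConstT c (Fin.natAdd n))
      (Formula.succT (Fin.natAdd n) (Fin.castAdd d ∘ x)))

/-- `ȳ = x̄ + c` for a numeral `c`. [folklore] -/
def Formula.shiftT : (c : ℕ) → {n : ℕ} → (Fin d → Fin n) → (Fin d → Fin n) → Formula (2 :: ar) rv n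
  | 0, _, x, y => Formula.eqT x y
  | c + 1, n, x, y => Formula.exs d (.and (Formula.shiftT c (Fin.castAdd d ∘ x) (Fin.natAdd n))
      (Formula.succT (Fin.natAdd n) (Fin.castAdd d ∘ y)))

variable {N : ℕ} (R : RelTables ar N) (V : RVAssign rv N)

/-- Outer variables under an appended block. [folklore] -/
theorem append_comp_castAdd {n : ℕ} {α : Type} (σ : Fin n → α) (a : Fin d → α) {m : ℕ} (x : Fin m → Fin n) :
    Fin.append σ a ∘ (Fin.castAdd d ∘ x) = σ ∘ x := by
  funext i; simp

/-- The outer part of an appended valuation. [folklore] -/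
@[simp] theorem append_comp_castAdd' {n : ℕ} {α : Type} (σ : Fin n → α) (a : Fin d → α) :
    Fin.append σ a ∘ Fin.castAdd d = σ := by
  funext i; simp

/-- The new part of an appended valuation. [folklore] -/
@[simp] theorem append_comp_natAdd {n : ℕ} {α : Type} (σ : Fin n → α) (a : Fin d → α) :
    Fin.append σ a ∘ Fin.natAdd n = a := by
  funext i; simp

/-- Semantics of `isConstT c`: the value is the numeral `c`. [folklore] -/
@[simp] theorem Formula.eval_isConstT : ∀ (c : ℕ) {n : ℕ} (x : Fin d → Fin n) (σ : Fin n → Fin N),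
    (Formula.isConstT c x : Formula (2 :: ar) rv n).eval (withNatOrder R) V σ ↔ tval (σ ∘ x) = c
  | 0, _, x, σ => by simp [Formula.isConstT]
  | c + 1, n, x, σ => by
    simp only [Formula.isConstT, Formula.eval_exs, Formula.eval_and', Formula.eval_isConstT c,
      Formula.eval_succT, append_comp_castAdd, append_comp_natAdd]
    constructor
    · rintro ⟨a, h1, h2⟩; omega
    · intro h
      have hc : c < N ^ d := by have := tval_lt (σ ∘ x); omega
      obtain ⟨a, ha⟩ := exists_tval_eq hc
      exact ⟨a, ha, by omega⟩

/-- Semantics of `shiftT c`: the values differ by the numeral `c`. [folklore] -/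
@[simp] theorem Formula.eval_shiftT : ∀ (c : ℕ) {n : ℕ} (x y : Fin d → Fin n) (σ : Fin n → Fin N),
    (Formula.shiftT c x y : Formula (2 :: ar) rv n).eval (withNatOrder R) V σ ↔
      tval (σ ∘ y) = tval (σ ∘ x) + c
  | 0, _, x, y, σ => by
    simp only [Formula.shiftT, Formula.eval_eqT, Nat.add_zero]
    exact ⟨fun h => by rw [h], fun h => tval_injective h.symm ▸ rfl⟩
  | c + 1, n, x, y, σ => by
    simp only [Formula.shiftT, Formula.eval_exs, Formula.eval_and', Formula.eval_shiftT c,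
      Formula.eval_succT, append_comp_castAdd, append_comp_natAdd]
    constructor
    · rintro ⟨a, h1, h2⟩; omega
    · intro h
      have hc : tval (σ ∘ x) + c < N ^ d := by have := tval_lt (σ ∘ y); omega
      obtain ⟨a, ha⟩ := exists_tval_eq hc
      exact ⟨a, ha, by omega⟩

end Consts

/-! ### Doubling, halving and parity (an inflationary induction) -/

section Dbl

variable {ar : List ℕ} {rv : List ℕ} {d : ℕ}

/-- Body of the doubling induction, relation variable `0` of arity `d + d`, its own arguments the
last `d + d` element variables: `(x̄ = 0 ∧ ȳ = 0) ∨ ∃ x̄₀ ȳ₀, D(x̄₀, ȳ₀) ∧ x̄ = x̄₀ + 1 ∧ ȳ = ȳ₀ + 2`. [folklore] -/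
def Formula.dblBody (n : ℕ) : Formula (2 :: ar) ((d + d) :: rv) (n + (d + d)) :=
  let x' : Fin d → Fin (n + (d + d)) := Fin.natAdd n ∘ Fin.castAdd d
  let y' : Fin d → Fin (n + (d + d)) := Fin.natAdd n ∘ Fin.natAdd d
  .or (.and (Formula.zeroT x') (Formula.zeroT y'))
    (Formula.exs (d + d)
      (let x₀ : Fin d → Fin (n + (d + d) + (d + d)) := Fin.natAdd (n + (d + d)) ∘ Fin.castAdd d
       let y₀ : Fin d → Fin (n + (d + d) + (d + d)) := Fin.natAdd (n + (d + d)) ∘ Fin.natAdd d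
       .and (Formula.rv0 (Fin.natAdd (n + (d + d))))
         (.and (Formula.succT x₀ (Fin.castAdd (d + d) ∘ x'))
           (Formula.shiftT 2 y₀ (Fin.castAdd (d + d) ∘ y')))))

/-- `ȳ = 2 x̄`, by inflationary induction. [cite: Gurevich1984, §4 (PDF p. 203: FO + LFP with order speaks about the digits of binary notation)] -/
def Formula.dblT {n : ℕ} (x y : Fin d → Fin n) : Formula (2 :: ar) rv n :=
  .fp (d + d) (Formula.dblBody n) (Fin.append x y)

variable {N : ℕ} (R : RelTables ar N) (V : RVAssign rv N)

/-- The doubling relation on pairs of tuples. [folklore] -/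
def dblSet (N d : ℕ) : Set (Fin (d + d) → Fin N) :=
  {a | tval (a ∘ Fin.natAdd d) = 2 * tval (a ∘ Fin.castAdd d)}

/-- Semantics of the body of the doubling induction, as an operator on sets of pairs of tuples. [folklore] -/
theorem Formula.eval_dblBody {n : ℕ} (σ : Fin n → Fin N) (S : Set (Fin (d + d) → Fin N))
    (a : Fin (d + d) → Fin N) :
    (Formula.dblBody n : Formula (2 :: ar) ((d + d) :: rv) (n + (d + d))).eval (withNatOrder R)
        (RVAssign.cons S V) (Fin.append σ a) ↔
      (tval (a ∘ Fin.castAdd d) = 0 ∧ tval (a ∘ Fin.natAdd d) = 0) ∨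
        ∃ b : Fin (d + d) → Fin N, b ∈ S ∧ tval (a ∘ Fin.castAdd d) = tval (b ∘ Fin.castAdd d) + 1 ∧
          tval (a ∘ Fin.natAdd d) = tval (b ∘ Fin.natAdd d) + 2 := by
  simp only [Formula.dblBody, Formula.eval_or', Formula.eval_and', Formula.eval_zeroT, Formula.eval_exs,
    Formula.eval_rv0, Formula.eval_succT, Formula.eval_shiftT]
  have e1 : Fin.append σ a ∘ (Fin.natAdd n ∘ Fin.castAdd d) = a ∘ Fin.castAdd d := by funext i; simp
  have e2 : Fin.append σ a ∘ (Fin.natAdd n ∘ Fin.natAdd d) = a ∘ Fin.natAdd d := by funext i; simp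
  have e3 : ∀ b : Fin (d + d) → Fin N,
      Fin.append (Fin.append σ a) b ∘ (Fin.natAdd (n + (d + d)) ∘ Fin.castAdd d) = b ∘ Fin.castAdd d := by
    intro b; funext i; simp
  have e4 : ∀ b : Fin (d + d) → Fin N,
      Fin.append (Fin.append σ a) b ∘ (Fin.natAdd (n + (d + d)) ∘ Fin.natAdd d) = b ∘ Fin.natAdd d := by
    intro b; funext i; simp
  have e5 : ∀ b : Fin (d + d) → Fin N,
      Fin.append (Fin.append σ a) b ∘ (Fin.castAdd (d + d) ∘ (Fin.natAdd n ∘ Fin.castAdd d)) =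
        a ∘ Fin.castAdd d := by
    intro b; funext i; simp
  have e6 : ∀ b : Fin (d + d) → Fin N,
      Fin.append (Fin.append σ a) b ∘ (Fin.castAdd (d + d) ∘ (Fin.natAdd n ∘ Fin.natAdd d)) =
        a ∘ Fin.natAdd d := by
    intro b; funext i; simp
  have e7 : ∀ b : Fin (d + d) → Fin N,
      Fin.append (Fin.append σ a) b ∘ Fin.natAdd (n + (d + d)) = b := by
    intro b; funext i; simp
  simp only [e1, e2, e3, e4, e5, e6, e7]

/-- The inflationary fixed point of the doubling induction is the graph of doubling (ranked induction on the argument). [folklore] -/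
theorem ifp_dbl {n : ℕ} (σ : Fin n → Fin N) :
    ifp (fun S : Set (Fin (d + d) → Fin N) =>
      {a | (Formula.dblBody n : Formula (2 :: ar) ((d + d) :: rv) (n + (d + d))).eval (withNatOrder R)
        (RVAssign.cons S V) (Fin.append σ a)}) = dblSet N d := by
  simp only [Formula.eval_dblBody]
  apply ifp_eq_of_rank (fun a => tval (a ∘ Fin.castAdd d))
  · intro i hi a ha
    simp only [Set.mem_setOf_eq] at ha
    show tval (a ∘ Fin.natAdd d) = 2 * tval (a ∘ Fin.castAdd d)
    rcases ha with ⟨h1, h2⟩ | ⟨b, hb, h1, h2⟩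
    · rw [h1, h2]
    · have hb' : tval (b ∘ Fin.natAdd d) = 2 * tval (b ∘ Fin.castAdd d) := hi hb
      omega
  · intro a ha S hS _
    have ha' : tval (a ∘ Fin.natAdd d) = 2 * tval (a ∘ Fin.castAdd d) := ha
    simp only [Set.mem_setOf_eq]
    rcases Nat.eq_zero_or_pos (tval (a ∘ Fin.castAdd d)) with h0 | hpos
    · left; exact ⟨h0, by rw [ha', h0]⟩
    · right
      obtain ⟨bx, hbx⟩ := exists_tval_eq (m := tval (a ∘ Fin.castAdd d) - 1) (N := N) (d := d)
        (by have := tval_lt (a ∘ Fin.castAdd d); omega)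
      obtain ⟨by_, hby⟩ := exists_tval_eq (m := tval (a ∘ Fin.natAdd d) - 2) (N := N) (d := d)
        (by have := tval_lt (a ∘ Fin.natAdd d); omega)
      have h2 := tval_lt (a ∘ Fin.castAdd d)
      refine ⟨Fin.append bx by_, hS ⟨?_, ?_⟩, ?_, ?_⟩
      · show tval (Fin.append bx by_ ∘ Fin.natAdd d) = 2 * tval (Fin.append bx by_ ∘ Fin.castAdd d)
        rw [append_comp_natAdd, append_comp_castAdd']
        omega
      · show tval (Fin.append bx by_ ∘ Fin.castAdd d) < tval (a ∘ Fin.castAdd d)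
        rw [append_comp_castAdd']
        omega
      · rw [append_comp_castAdd']; omega
      · rw [append_comp_natAdd]; omega

end Dbl

section DblAPI

variable {ar : List ℕ} {rv : List ℕ} {d n : ℕ} {N : ℕ} (R : RelTables ar N) (V : RVAssign rv N)
  (σ : Fin n → Fin N)

/-- Semantics of `dblT`: `tval ȳ = 2 · tval x̄`. [folklore] -/
@[simp] theorem Formula.eval_dblT (x y : Fin d → Fin n) :
    (Formula.dblT x y : Formula (2 :: ar) rv n).eval (withNatOrder R) V σ ↔
      tval (σ ∘ y) = 2 * tval (σ ∘ x) := by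
  rw [Formula.dblT, Formula.eval_fp', ifp_dbl]
  simp only [dblSet, Set.mem_setOf_eq]
  rw [Function.comp_assoc, Function.comp_assoc, append_comp_natAdd, append_comp_castAdd']

/-- `h̄ = ⌊x̄ / 2⌋`. [folklore] -/
def Formula.halfT (x h : Fin d → Fin n) : Formula (2 :: ar) rv n :=
  .or (Formula.dblT h x)
    (Formula.exs d (.and (Formula.dblT (Fin.castAdd d ∘ h) (Fin.natAdd n))
      (Formula.succT (Fin.natAdd n) (Fin.castAdd d ∘ x))))

/-- `x̄` is odd. [folklore] -/
def Formula.oddT (x : Fin d → Fin n) : Formula (2 :: ar) rv n :=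
  Formula.exs d (Formula.exs d
    (.and (Formula.dblT (Fin.castAdd d ∘ Fin.natAdd n) (Fin.natAdd (n + d)))
      (Formula.succT (Fin.natAdd (n + d)) (Fin.castAdd d ∘ Fin.castAdd d ∘ x))))

/-- Semantics of `halfT`: `tval h̄ = ⌊tval x̄ / 2⌋`. [folklore] -/
@[simp] theorem Formula.eval_halfT (x h : Fin d → Fin n) :
    (Formula.halfT x h : Formula (2 :: ar) rv n).eval (withNatOrder R) V σ ↔
      tval (σ ∘ h) = tval (σ ∘ x) / 2 := by
  simp only [Formula.halfT, Formula.eval_or', Formula.eval_dblT, Formula.eval_exs, Formula.eval_and',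
    Formula.eval_succT, append_comp_castAdd, append_comp_natAdd]
  constructor
  · rintro (h1 | ⟨a, h1, h2⟩) <;> omega
  · intro hh
    rcases Nat.even_or_odd (tval (σ ∘ x)) with ⟨m, hm⟩ | ⟨m, hm⟩
    · left; omega
    · right
      obtain ⟨a, ha⟩ := exists_tval_eq (N := N) (d := d) (m := 2 * m) (by have := tval_lt (σ ∘ x); omega)
      exact ⟨a, by omega, by omega⟩

/-- Semantics of `oddT`: `tval x̄` is odd. [folklore] -/
@[simp] theorem Formula.eval_oddT (x : Fin d → Fin n) :
    (Formula.oddT x : Formula (2 :: ar) rv n).eval (withNatOrder R) V σ ↔ tval (σ ∘ x) % 2 = 1 := by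
  simp only [Formula.oddT, Formula.eval_exs, Formula.eval_and', Formula.eval_dblT, Formula.eval_succT]
  have e1 : ∀ (a b : Fin d → Fin N), Fin.append (Fin.append σ a) b ∘ (Fin.castAdd d ∘ Fin.natAdd n) = a := by
    intro a b; funext i; simp
  have e2 : ∀ (a b : Fin d → Fin N), Fin.append (Fin.append σ a) b ∘ Fin.natAdd (n + d) = b := by
    intro a b; funext i; simp
  have e3 : ∀ (a b : Fin d → Fin N),
      Fin.append (Fin.append σ a) b ∘ (Fin.castAdd d ∘ Fin.castAdd d ∘ x) = σ ∘ x := by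
    intro a b; funext i; simp
  simp only [e1, e2, e3]
  constructor
  · rintro ⟨a, b, h1, h2⟩; omega
  · intro h
    obtain ⟨m, hm⟩ : Odd (tval (σ ∘ x)) := Nat.odd_iff.mpr h
    have hx := tval_lt (σ ∘ x)
    obtain ⟨a, ha⟩ := exists_tval_eq (N := N) (d := d) (m := m) (by omega)
    obtain ⟨b, hb⟩ := exists_tval_eq (N := N) (d := d) (m := 2 * m) (by omega)
    exact ⟨a, b, by omega, by omega⟩

end DblAPI

/-! ### Powers of `N` and codes of finite data -/

section Codes

variable {ar : List ℕ} {rv : List ℕ} {d n : ℕ}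

/-- `x_a = 1` (the second element). [folklore] -/
def Formula.oneV (a : Fin n) : Formula (2 :: ar) rv n :=
  .ex (.and (Formula.zeroV (Fin.last n)) (Formula.succV (Fin.last n) a.castSucc))

/-- `x̄ = N ^ k` (digit `k` is `1`, the others `0`). [folklore] -/
def Formula.isPowT (k : Fin d) (x : Fin d → Fin n) : Formula (2 :: ar) rv n :=
  Formula.iAnd fun i => if i = k then Formula.oneV (x i) else Formula.zeroV (x i)

/-- `x̄` carries the Boolean code `c`: digit `l` is the greatest element where `c l`, else `0`. [folklore] -/
def Formula.isCode {m : ℕ} (c : Fin m → Bool) (x : Fin m → Fin n) : Formula (2 :: ar) rv n :=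
  Formula.iAnd fun l => if c l then Formula.maxV (x l) else Formula.zeroV (x l)

variable {N : ℕ} (R : RelTables ar N) (V : RVAssign rv N) (σ : Fin n → Fin N)

/-- Semantics of `oneV`: the element `1`. [folklore] -/
@[simp] theorem Formula.eval_oneV (a : Fin n) :
    (Formula.oneV a : Formula (2 :: ar) rv n).eval (withNatOrder R) V σ ↔ (σ a : ℕ) = 1 := by
  simp only [Formula.oneV, Formula.eval_ex', Formula.eval_and', Formula.eval_zeroV, Formula.eval_succV,
    Fin.snoc_last, Fin.snoc_castSucc]
  constructor
  · rintro ⟨z, h1, h2⟩; omega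
  · intro h; exact ⟨⟨0, by have := (σ a).2; omega⟩, rfl, by simp [h]⟩

/-- The tuple coding `N ^ k`. [folklore] -/
theorem tval_eq_pow_iff (hN : 2 ≤ N) (v : Fin d → Fin N) (k : Fin d) :
    tval v = N ^ (k : ℕ) ↔ ∀ i, (v i : ℕ) = if i = k then 1 else 0 := by
  haveI : NeZero N := ⟨by omega⟩
  have hsingle : tval (Pi.single k (⟨1, hN⟩ : Fin N)) = N ^ (k : ℕ) := by
    rw [tval, finFunctionFinEquiv_single]; simp
  rw [← hsingle, tval_injective.eq_iff, funext_iff]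
  refine forall_congr' fun i => ?_
  by_cases h : i = k
  · subst h
    rw [Pi.single_eq_same, if_pos rfl, Fin.ext_iff]
  · rw [Pi.single_eq_of_ne h, if_neg h, Fin.ext_iff]
    simp

/-- Semantics of `isPowT k` (`N ≥ 2`): the value is `N ^ k`. [folklore] -/
@[simp] theorem Formula.eval_isPowT (hN : 2 ≤ N) (k : Fin d) (x : Fin d → Fin n) :
    (Formula.isPowT k x : Formula (2 :: ar) rv n).eval (withNatOrder R) V σ ↔
      tval (σ ∘ x) = N ^ (k : ℕ) := by
  rw [tval_eq_pow_iff hN]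
  simp only [Formula.isPowT, Formula.eval_iAnd, Function.comp_apply]
  refine forall_congr' fun i => ?_
  by_cases h : i = k <;> simp [h]

/-- The tuple of elements coding `c`. [folklore] -/
def codeVal (N : ℕ) {m : ℕ} (hN : 1 ≤ N) (c : Fin m → Bool) : Fin m → Fin N :=
  fun l => if c l then ⟨N - 1, by omega⟩ else ⟨0, by omega⟩

/-- Coding of Boolean vectors by tuples is injective once `N ≥ 2`. [folklore] -/
theorem codeVal_injective (hN : 2 ≤ N) {m : ℕ} :
    Function.Injective (codeVal N (m := m) (by omega)) := by
  intro c c' h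
  funext l
  have := congrFun h l
  simp only [codeVal] at this
  cases hc : c l <;> cases hc' : c' l <;> simp_all [Fin.ext_iff] <;> omega

/-- Semantics of `isCode c`: the tuple is the code tuple `codeVal c`. [folklore] -/
@[simp] theorem Formula.eval_isCode (hN : 1 ≤ N) {m : ℕ} (c : Fin m → Bool) (x : Fin m → Fin n) :
    (Formula.isCode c x : Formula (2 :: ar) rv n).eval (withNatOrder R) V σ ↔ σ ∘ x = codeVal N hN c := by
  simp only [Formula.isCode, Formula.eval_iAnd, funext_iff, Function.comp_apply, codeVal]
  refine forall_congr' fun l => ?_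
  by_cases h : c l <;> simp [h, Fin.ext_iff]

end Codes

/-! ### Generic inflationary iteration of a definable step along a counter -/

section Iter

variable {ar : List ℕ} {rv : List ℕ} {d e n : ℕ}

/-- Iterated reachability: `ReachIn B S i y` iff `y` is reached from some `B`-element by `i`
`S`-steps. [folklore] -/
def ReachIn {β : Type} (B : β → Prop) (S : β → β → Prop) : ℕ → β → Prop
  | 0, y => B y
  | i + 1, y => ∃ y₀, ReachIn B S i y₀ ∧ S y₀ y

/-- For a unique base point and a functional step, `ReachIn` is iteration. [folklore] -/
theorem reachIn_iff_iterate {β : Type} {B : β → Prop} {S : β → β → Prop} (b : β) (f : β → β)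
    (hB : ∀ y, B y ↔ y = b) (hS : ∀ y₀ y, S y₀ y ↔ y = f y₀) :
    ∀ (i : ℕ) (y : β), ReachIn B S i y ↔ y = f^[i] b
  | 0, y => by simp [ReachIn, hB]
  | i + 1, y => by
    simp only [ReachIn, reachIn_iff_iterate b f hB hS i, hS, Function.iterate_succ_apply']
    constructor
    · rintro ⟨y₀, rfl, rfl⟩; rfl
    · rintro rfl; exact ⟨_, rfl, rfl⟩

/-- A formula builder in `e` tuple variables with access to the `n` outer variables through a
renaming `ι`, usable at any binder depth `m` and in any relation-variable context. [folklore] -/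
abbrev TBuilder (ar : List ℕ) (n e : ℕ) : Type :=
  ∀ ⦃rv' : List ℕ⦄ ⦃m : ℕ⦄, (Fin n → Fin m) → (Fin e → Fin m) → Formula (2 :: ar) rv' m

/-- A builder in two `e`-tuples. [folklore] -/
abbrev TBuilder₂ (ar : List ℕ) (n e : ℕ) : Type :=
  ∀ ⦃rv' : List ℕ⦄ ⦃m : ℕ⦄, (Fin n → Fin m) → (Fin e → Fin m) → (Fin e → Fin m) → Formula (2 :: ar) rv' m

variable {N : ℕ} (R : RelTables ar N)

/-- Correctness of a builder w.r.t. a semantic relation on (outer valuation, tuple). [folklore] -/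
abbrev TBuilder.Realizes (B : TBuilder ar n e) (Sem : (Fin n → Fin N) → (Fin e → Fin N) → Prop) : Prop :=
  ∀ ⦃rv' : List ℕ⦄ ⦃m : ℕ⦄ (V' : RVAssign rv' N) (τ : Fin m → Fin N) (ι : Fin n → Fin m) (y : Fin e → Fin m),
    (B ι y).eval (withNatOrder R) V' τ ↔ Sem (τ ∘ ι) (τ ∘ y)

/-- Correctness of a two-tuple builder. [folklore] -/
abbrev TBuilder₂.Realizes (B : TBuilder₂ ar n e)
    (Sem : (Fin n → Fin N) → (Fin e → Fin N) → (Fin e → Fin N) → Prop) : Prop :=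
  ∀ ⦃rv' : List ℕ⦄ ⦃m : ℕ⦄ (V' : RVAssign rv' N) (τ : Fin m → Fin N) (ι : Fin n → Fin m)
    (y₀ y : Fin e → Fin m), (B ι y₀ y).eval (withNatOrder R) V' τ ↔ Sem (τ ∘ ι) (τ ∘ y₀) (τ ∘ y)

/-- Body of the iteration `IT(ī, ȳ) :↔ (ī = 0 ∧ Base ȳ) ∨ ∃ ī₀ ȳ₀ (IT(ī₀, ȳ₀) ∧ ī = ī₀ + 1 ∧ Step ȳ₀ ȳ)`;
relation variable `0` of arity `d + e`; outer variables `Fin.castAdd (d + e)`. [folklore] -/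
def Formula.iterBody (base : TBuilder ar n e) (step : TBuilder₂ ar n e) :
    Formula (2 :: ar) ((d + e) :: rv) (n + (d + e)) :=
  let ι : Fin n → Fin (n + (d + e)) := Fin.castAdd (d + e)
  let i' : Fin d → Fin (n + (d + e)) := Fin.natAdd n ∘ Fin.castAdd e
  let y' : Fin e → Fin (n + (d + e)) := Fin.natAdd n ∘ Fin.natAdd d
  .or (.and (Formula.zeroT i') (base ι y'))
    (Formula.exs (d + e)
      (let lift : Fin (n + (d + e)) → Fin (n + (d + e) + (d + e)) := Fin.castAdd (d + e)
       let i₀ : Fin d → Fin (n + (d + e) + (d + e)) := Fin.natAdd (n + (d + e)) ∘ Fin.castAdd e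
       let y₀ : Fin e → Fin (n + (d + e) + (d + e)) := Fin.natAdd (n + (d + e)) ∘ Fin.natAdd d
       .and (Formula.rv0 (Fin.natAdd (n + (d + e))))
         (.and (Formula.succT i₀ (lift ∘ i')) (step (lift ∘ ι) y₀ (lift ∘ y')))))

/-- `IT(ī, ȳ)`: `ȳ` is reached from a `Base` tuple by `ī` `Step`s. [cite: Gurevich1984, §4 (PDF p. 203: FO + LFP with order speaks about the digits of binary notation)] -/
def Formula.iterT (base : TBuilder ar n e) (step : TBuilder₂ ar n e) (i : Fin d → Fin n)
    (y : Fin e → Fin n) : Formula (2 :: ar) rv n :=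
  .fp (d + e) (Formula.iterBody base step) (Fin.append i y)

variable (V : RVAssign rv N)

/-- Semantics of the body of the iteration combinator, as an operator on sets of (counter, tuple) pairs. [folklore] -/
theorem Formula.eval_iterBody {base : TBuilder ar n e} {step : TBuilder₂ ar n e}
    {SemB : (Fin n → Fin N) → (Fin e → Fin N) → Prop}
    {SemS : (Fin n → Fin N) → (Fin e → Fin N) → (Fin e → Fin N) → Prop}
    (hB : TBuilder.Realizes R base SemB) (hS : TBuilder₂.Realizes R step SemS)
    (σ : Fin n → Fin N) (S : Set (Fin (d + e) → Fin N)) (a : Fin (d + e) → Fin N) :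
    (Formula.iterBody base step : Formula (2 :: ar) ((d + e) :: rv) (n + (d + e))).eval (withNatOrder R)
        (RVAssign.cons S V) (Fin.append σ a) ↔
      (tval (a ∘ Fin.castAdd e) = 0 ∧ SemB σ (a ∘ Fin.natAdd d)) ∨
        ∃ b : Fin (d + e) → Fin N, b ∈ S ∧ tval (a ∘ Fin.castAdd e) = tval (b ∘ Fin.castAdd e) + 1 ∧
          SemS σ (b ∘ Fin.natAdd d) (a ∘ Fin.natAdd d) := by
  simp only [Formula.iterBody, Formula.eval_or', Formula.eval_and', Formula.eval_zeroT, Formula.eval_exs,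
    Formula.eval_rv0, Formula.eval_succT, hB, hS]
  have e1 : Fin.append σ a ∘ (Fin.natAdd n ∘ Fin.castAdd e) = a ∘ Fin.castAdd e := by funext i; simp
  have e2 : Fin.append σ a ∘ (Fin.natAdd n ∘ Fin.natAdd d) = a ∘ Fin.natAdd d := by funext i; simp
  have e0 : Fin.append σ a ∘ Fin.castAdd (d + e) = σ := by funext i; simp
  have e3 : ∀ b : Fin (d + e) → Fin N,
      Fin.append (Fin.append σ a) b ∘ (Fin.natAdd (n + (d + e)) ∘ Fin.castAdd e) = b ∘ Fin.castAdd e := by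
    intro b; funext i; simp
  have e4 : ∀ b : Fin (d + e) → Fin N,
      Fin.append (Fin.append σ a) b ∘ (Fin.natAdd (n + (d + e)) ∘ Fin.natAdd d) = b ∘ Fin.natAdd d := by
    intro b; funext i; simp
  have e5 : ∀ b : Fin (d + e) → Fin N,
      Fin.append (Fin.append σ a) b ∘ (Fin.castAdd (d + e) ∘ (Fin.natAdd n ∘ Fin.castAdd e)) =
        a ∘ Fin.castAdd e := by
    intro b; funext i; simp
  have e6 : ∀ b : Fin (d + e) → Fin N,
      Fin.append (Fin.append σ a) b ∘ (Fin.castAdd (d + e) ∘ (Fin.natAdd n ∘ Fin.natAdd d)) =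
        a ∘ Fin.natAdd d := by
    intro b; funext i; simp
  have e7 : ∀ b : Fin (d + e) → Fin N,
      Fin.append (Fin.append σ a) b ∘ Fin.natAdd (n + (d + e)) = b := by
    intro b; funext i; simp
  have e8 : ∀ b : Fin (d + e) → Fin N,
      Fin.append (Fin.append σ a) b ∘ (Fin.castAdd (d + e) ∘ Fin.castAdd (d + e)) = σ := by
    intro b; funext i; simp
  simp only [e0, e1, e2, e3, e4, e5, e6, e7, e8]

/-- The set of the iteration. [folklore] -/
def iterSet (SemB : (Fin e → Fin N) → Prop) (SemS : (Fin e → Fin N) → (Fin e → Fin N) → Prop) :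
    Set (Fin (d + e) → Fin N) :=
  {a | ReachIn SemB SemS (tval (a ∘ Fin.castAdd e)) (a ∘ Fin.natAdd d)}

/-- The inflationary fixed point of the iteration combinator is the iterated-reachability set (ranked induction on the counter). [folklore] -/
theorem ifp_iter {base : TBuilder ar n e} {step : TBuilder₂ ar n e}
    {SemB : (Fin n → Fin N) → (Fin e → Fin N) → Prop}
    {SemS : (Fin n → Fin N) → (Fin e → Fin N) → (Fin e → Fin N) → Prop}
    (hB : TBuilder.Realizes R base SemB) (hS : TBuilder₂.Realizes R step SemS) (σ : Fin n → Fin N) :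
    ifp (fun S : Set (Fin (d + e) → Fin N) =>
      {a | (Formula.iterBody base step : Formula (2 :: ar) ((d + e) :: rv) (n + (d + e))).eval
        (withNatOrder R) (RVAssign.cons S V) (Fin.append σ a)}) = iterSet (SemB σ) (SemS σ) := by
  simp only [Formula.eval_iterBody R V hB hS]
  apply ifp_eq_of_rank (fun a => tval (a ∘ Fin.castAdd e))
  · intro i hi a ha
    simp only [Set.mem_setOf_eq] at ha
    show ReachIn (SemB σ) (SemS σ) (tval (a ∘ Fin.castAdd e)) (a ∘ Fin.natAdd d)
    rcases ha with ⟨h1, h2⟩ | ⟨b, hb, h1, h2⟩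
    · rw [h1]; exact h2
    · have hb' : ReachIn (SemB σ) (SemS σ) (tval (b ∘ Fin.castAdd e)) (b ∘ Fin.natAdd d) := hi hb
      rw [h1]; exact ⟨_, hb', h2⟩
  · intro a ha S hS _
    have ha' : ReachIn (SemB σ) (SemS σ) (tval (a ∘ Fin.castAdd e)) (a ∘ Fin.natAdd d) := ha
    simp only [Set.mem_setOf_eq]
    rcases h : tval (a ∘ Fin.castAdd e) with _ | m
    · left; rw [h] at ha'; exact ⟨rfl, ha'⟩
    · right
      rw [h] at ha'
      obtain ⟨y₀, hy₀, hst⟩ := ha'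
      obtain ⟨bi, hbi⟩ := exists_tval_eq (m := m) (N := N) (d := d)
        (by have := tval_lt (a ∘ Fin.castAdd e); omega)
      refine ⟨Fin.append bi y₀, hS ⟨?_, ?_⟩, ?_, ?_⟩
      · show ReachIn (SemB σ) (SemS σ) (tval (Fin.append bi y₀ ∘ Fin.castAdd e)) (Fin.append bi y₀ ∘ Fin.natAdd d)
        rw [append_comp_natAdd, append_comp_castAdd', hbi]; exact hy₀
      · show tval (Fin.append bi y₀ ∘ Fin.castAdd e) < tval (a ∘ Fin.castAdd e)
        rw [append_comp_castAdd']; omega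
      · rw [append_comp_castAdd']; omega
      · rw [append_comp_natAdd]; exact hst

/-- **Semantics of the iteration combinator.** [folklore] -/
theorem Formula.eval_iterT {base : TBuilder ar n e} {step : TBuilder₂ ar n e}
    {SemB : (Fin n → Fin N) → (Fin e → Fin N) → Prop}
    {SemS : (Fin n → Fin N) → (Fin e → Fin N) → (Fin e → Fin N) → Prop}
    (hB : TBuilder.Realizes R base SemB) (hS : TBuilder₂.Realizes R step SemS) (σ : Fin n → Fin N)
    (i : Fin d → Fin n) (y : Fin e → Fin n) :
    (Formula.iterT base step i y : Formula (2 :: ar) rv n).eval (withNatOrder R) V σ ↔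
      ReachIn (SemB σ) (SemS σ) (tval (σ ∘ i)) (σ ∘ y) := by
  rw [Formula.iterT, Formula.eval_fp', ifp_iter R V hB hS]
  simp only [iterSet, Set.mem_setOf_eq]
  rw [Function.comp_assoc, Function.comp_assoc, append_comp_natAdd, append_comp_castAdd']

end Iter

/-! ### Instances: addition, powers of two, iterated halving of `N` -/

section IterInstances

variable {ar : List ℕ} {rv : List ℕ} {d n : ℕ}

/-- `z̄ = x̄ + ȳ` (`z̄` reached from `x̄` by `ȳ` successor steps). [cite: Gurevich1984, §4 (PDF p. 203: FO + LFP with order speaks about the digits of binary notation)] -/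
def Formula.addT (x y z : Fin d → Fin n) : Formula (2 :: ar) rv n :=
  Formula.iterT (e := d) (fun _ _ ι w => Formula.eqT (ι ∘ x) w) (fun _ _ _ w₀ w => Formula.succT w₀ w) y z

/-- `z̄ = 2 ^ ī`. [cite: Gurevich1984, §4 (PDF p. 203: FO + LFP with order speaks about the digits of binary notation)] -/
def Formula.powTwoT (i z : Fin d → Fin n) : Formula (2 :: ar) rv n :=
  Formula.iterT (e := d) (fun _ _ _ w => Formula.isConstT 1 w) (fun _ _ _ w₀ w => Formula.dblT w₀ w) i z

/-- `z̄ = ⌊M / 2 ^ ī⌋` where `M = N ^ k` is given as a power of the size of the universe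
(`k = 1`: the iterated halvings of `N`, whose parities are the binary digits of `N`). [cite: Gurevich1984, §4 (PDF p. 203: FO + LFP with order speaks about the digits of binary notation)] -/
def Formula.divPowTwoT (k : Fin d) (i z : Fin d → Fin n) : Formula (2 :: ar) rv n :=
  Formula.iterT (e := d) (fun _ _ _ w => Formula.isPowT k w) (fun _ _ _ w₀ w => Formula.halfT w₀ w) i z

variable {N : ℕ} (R : RelTables ar N) (V : RVAssign rv N) (σ : Fin n → Fin N)

/-- Iterating the successor `m` times from `b̄` reaches exactly the tuples of value `tval b̄ + m`. [folklore] -/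
theorem reachIn_add {e : ℕ} (b : Fin e → Fin N) :
    ∀ (m : ℕ) (w : Fin e → Fin N),
      ReachIn (fun w => w = b) (fun w₀ w => tval w = tval w₀ + 1) m w ↔ tval w = tval b + m
  | 0, w => by
    simp only [ReachIn, Nat.add_zero]
    exact ⟨fun h => by rw [h], fun h => tval_injective h⟩
  | m + 1, w => by
    simp only [ReachIn, reachIn_add b m]
    constructor
    · rintro ⟨w₀, h1, h2⟩; omega
    · intro h
      obtain ⟨w₀, hw₀⟩ := exists_tval_eq (N := N) (d := e) (m := tval b + m) (by have := tval_lt w; omega)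
      exact ⟨w₀, hw₀, by omega⟩

/-- Iterating doubling `m` times from `1` reaches exactly the tuples of value `2 ^ m`. [folklore] -/
theorem reachIn_powTwo {e : ℕ} :
    ∀ (m : ℕ) (w : Fin e → Fin N),
      ReachIn (fun w => tval w = 1) (fun w₀ w => tval w = 2 * tval w₀) m w ↔ tval w = 2 ^ m
  | 0, w => by simp [ReachIn]
  | m + 1, w => by
    simp only [ReachIn, reachIn_powTwo m]
    constructor
    · rintro ⟨w₀, h1, h2⟩; rw [h2, h1, pow_succ]; ring
    · intro h
      obtain ⟨w₀, hw₀⟩ := exists_tval_eq (N := N) (d := e) (m := 2 ^ m)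
        (by have := tval_lt w; rw [pow_succ] at h; omega)
      exact ⟨w₀, hw₀, by rw [h, hw₀, pow_succ]; ring⟩

/-- Iterating halving `m` times from `M` reaches exactly the tuples of value `M / 2 ^ m`. [folklore] -/
theorem reachIn_divPowTwo {e : ℕ} (M : ℕ) (hM : M < N ^ e) :
    ∀ (m : ℕ) (w : Fin e → Fin N),
      ReachIn (fun w => tval w = M) (fun w₀ w => tval w = tval w₀ / 2) m w ↔ tval w = M / 2 ^ m
  | 0, w => by simp [ReachIn]
  | m + 1, w => by
    simp only [ReachIn, reachIn_divPowTwo M hM m]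
    constructor
    · rintro ⟨w₀, h1, h2⟩; rw [h2, h1, pow_succ, Nat.div_div_eq_div_mul]
    · intro h
      obtain ⟨w₀, hw₀⟩ := exists_tval_eq (N := N) (d := e) (m := M / 2 ^ m)
        (lt_of_le_of_lt (Nat.div_le_self _ _) hM)
      exact ⟨w₀, hw₀, by rw [h, hw₀, pow_succ, Nat.div_div_eq_div_mul]⟩

/-- Semantics of `addT`: `tval z̄ = tval x̄ + tval ȳ`. [folklore] -/
@[simp] theorem Formula.eval_addT (x y z : Fin d → Fin n) :
    (Formula.addT x y z : Formula (2 :: ar) rv n).eval (withNatOrder R) V σ ↔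
      tval (σ ∘ z) = tval (σ ∘ x) + tval (σ ∘ y) := by
  rw [Formula.addT, Formula.eval_iterT R V (SemB := fun τ w => w = τ ∘ x)
    (SemS := fun _ w₀ w => tval w = tval w₀ + 1), reachIn_add]
  · intro rv' m V' τ ι w
    rw [Formula.eval_eqT]
    show τ ∘ (ι ∘ x) = τ ∘ w ↔ τ ∘ w = (τ ∘ ι) ∘ x
    rw [Function.comp_assoc]; exact eq_comm
  · intro rv' m V' τ ι w₀ w
    exact Formula.eval_succT R V' τ w₀ w

/-- Semantics of `powTwoT`: `tval z̄ = 2 ^ tval ī`. [folklore] -/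
@[simp] theorem Formula.eval_powTwoT (i z : Fin d → Fin n) :
    (Formula.powTwoT i z : Formula (2 :: ar) rv n).eval (withNatOrder R) V σ ↔
      tval (σ ∘ z) = 2 ^ tval (σ ∘ i) := by
  rw [Formula.powTwoT, Formula.eval_iterT R V (SemB := fun _ w => tval w = 1)
    (SemS := fun _ w₀ w => tval w = 2 * tval w₀), reachIn_powTwo]
  · intro rv' m V' τ ι w
    exact Formula.eval_isConstT R V' 1 w τ
  · intro rv' m V' τ ι w₀ w
    exact Formula.eval_dblT R V' τ w₀ w

/-- Semantics of `divPowTwoT k` (`N ≥ 2`): `tval z̄ = ⌊N ^ k / 2 ^ tval ī⌋`. [folklore] -/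
@[simp] theorem Formula.eval_divPowTwoT (hN : 2 ≤ N) (k : Fin d) (i z : Fin d → Fin n) :
    (Formula.divPowTwoT k i z : Formula (2 :: ar) rv n).eval (withNatOrder R) V σ ↔
      tval (σ ∘ z) = N ^ (k : ℕ) / 2 ^ tval (σ ∘ i) := by
  rw [Formula.divPowTwoT, Formula.eval_iterT R V (SemB := fun _ w => tval w = N ^ (k : ℕ))
    (SemS := fun _ w₀ w => tval w = tval w₀ / 2),
    reachIn_divPowTwo _ (Nat.pow_lt_pow_right (by omega) k.2)]
  · intro rv' m V' τ ι w
    exact Formula.eval_isPowT R V' τ hN k w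
  · intro rv' m V' τ ι w₀ w
    exact Formula.eval_halfT R V' τ w₀ w

end IterInstances

end Literature.ModelTheory.FiniteModelTheory
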